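import Literature.MathematicalPhysics.QuantumFieldTheory.Balaban1983to89.Beta.KernelSpecInstance
import Literature.MathematicalPhysics.QuantumFieldTheory.Balaban1983to89.Beta.DressedMomentNormalisation

/-!
# Bałaban's lattice YM₄ RG programme — β-function sub-cell: `IdentityForm` FOR THE KERNELS OF THE TYPED KKT SOLUTION OPERATOR
# (the kernel route P1-K assembled end to end: no `InfiniteVolumeSpec` hypothesis, no `hrep` hypothesis)

HONEST FRAMING (cell rule, verbatim): «discharging BetaPertH makes Balaban's UV stability UNCONDITIONAL — a real
constructive-QFT result; it is NOT the continuum limit and NOT the Clay problem.»  This module formalises NO statement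
printed in Bałaban's papers and cites none; it is the [folklore] COMPOSITION of sibling leaves of the cell's kernel route
P1-K (RULING (R13-2)/(R14-1) of the β sub-cell), all already in the tree:

* `Beta/KernelSpecInstance` (row BETA-an2): the INSTANCE `specK : AffineReproduction.InfiniteVolumeSpec (d+1) N` — the
  solution operator of the typed block-periodic gauge-fixed KKT system on `ℤ^{d+1}` (EL rows, Q-row source, block-constant
  gauge function, block-mean-free multiplier) as absolutely convergent KERNEL SUMS over the real fundamental columns
  `wH κ l : ℤ^{d+1} → ℝ` (real parts of the Bloch–Green columns of `Beta/BlochFibreMatrix`, exponentially decaying by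
  `Beta/FibreInverseDecay`), with `specK_H : specK.H = kernelOpSum N wH` BY `rfl`, `absMoment₂_wH` and
  `lowMomentsSum_specK` (= `KernelRepresentationSummable.lowMomentsSum_of_spec`, sub-cell B12, fed with the instance);
* `Beta/KernelRepresentationSummable` (sub-cell B12): (T0)/(T1) for a matrix kernel from the two lattice symmetries
  (`lowMomentsSum_of_symmetries`);
* `Beta/DressedMomentNormalisation` (row BETA-an2): the normalisation last mile — `EntryHyps N w T` ⟹ the decimated second
  moment of `Wᵀ T W`, the bond normalisation, `coarseTensor N w T = m2Tensor T`, and for families of scales in `d = 4`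
  `MarginalTelescoping.IdentityForm` for any read-out `F` (`identityForm_of_kernelFamilies(')`).

THIS FILE feeds the instance into the last mile: the `EntryHyps` fields `pos/const/lin/absW` are DISCHARGED by
`NeZero N`, `lowMomentsSum_specK` and `absMoment₂_wH` at `d + 1 = 4`.  What survives as hypotheses is exactly the
HESSIAN-KERNEL DATA of the window (`T j` with `AbsMoment₂` entries and (T0)/(T1), or the two symmetries stated as the raw
binders of `lowMomentsSum_of_symmetries`) and the READ-OUT `F` — nothing about the solution operator.  The GENERAL-spec packaging of
the same composition (any `S` with `hrep : S.H = kernelOpSum N w`) is sub-cell B12's sibling `Beta/KernelSpecIdentityForm`;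
this file states only the instance and deliberately imports nothing that is not yet in the tree.

READING, NOT A THEOREM OF THIS FILE: «minimiser» in this file's name and identifiers is a LABEL for the solution
operator `KernelSpecInstance.specK` of the TYPED `U = 1` block-averaging KKT system (`AffineReproduction.InfiniteVolumeSpec`);
its identification with Bałaban's `U = 1` gauge-fixed constrained minimiser ([Balaban1984PropagatorsI, p. 26,
(1.47)–(1.50)]; background-field form [Balaban1985BackgroundPropagators, p. 394, (3.20)–(3.24)]) and of the window `T` /
read-out `F` with the b₀-normalisation of the second-order effective-action term is a READING maintained by the
sub-cell's literature rows — NOT proved here, NOT cited as a fact, NEVER used as a hypothesis; the pointers are context only.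

WHAT THIS FILE PROVES (all [folklore]; `d + 1 = 4` where stated).
* §1 fixed block size `N ≠ 0`: `wK N := wH (d := 3)` (the four-dimensional response kernel), `lowMoments_wK` ((L0∞)/(L1∞)
  windowed coset moments of the solution-operator kernel, = `KernelSpecInstance.lowMomentsSum_specK` at `d = 3`),
  `entryHyps_minimiser` (`DressedMomentNormalisation.EntryHyps N (wK N) T` from the Hessian data alone),
  `entryHyps_minimiser_of_symmetries` ((T0)/(T1) from backward-difference divergence-freeness and midpoint inversion of
  `T`), `secondMoment_dressedEntry_minimiser`, `bondSecondMoment_minimiser`, `coarseTensor_minimiser(_of_symmetries)` (the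
  coarse bond tensor of the dressed solution-operator kernel IS `m2Tensor T`).
* §2 families of scales: `identityForm_of_minimiserFamilies` — for ANY block sizes `Nf j k ≠ 0`, Hessian kernels `T j`
  with `AbsMoment₂` entries and (T0)/(T1), and any read-out `F`,
  `IdentityForm (fun j k => F (coarseTensor (Nf j k) (wK (Nf j k)) (T j))) (fun j => F (m2Tensor (T j)))`;
  the `hident`-side variant `identityForm_of_minimiserFamilies'` (`β0 j = F (m2Tensor (T j))` a hypothesis);
  `identityForm_of_minimiserFamilies_of_symmetries`; and the cell's geometric block sizes `Nf j k = L ^ (k - j)`: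
  `identityForm_of_minimiserFamilies_pow(_of_symmetries)`.

WHAT THIS FILE DOES NOT DO.  It does not identify the typed KKT system with Bałaban's gauge-fixed linearisation of the
block-averaging constraint at `U = 1` (the cell's READING, AN2 (Y15)(b) — never cited, never a hypothesis here); it does
not identify the cell's composed coefficients `μC j k` with the read-out `F (coarseTensor …)` nor `β⁰_j` with
`F (m2Tensor (T j))` (the `hident`/`hβ` side of the lead's `Beta/ComposedRoad`, hypotheses of the primed variant); it
says nothing about the Hessian kernels `T j` of Bałaban's effective actions (their `AbsMoment₂`, (T0)/(T1) or symmetries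
are HYPOTHESES), nothing about (M2⁺)/`BetaPertH`'s SIZE statement (the wall), the sign of any coefficient, the continuum
limit or the Clay problem.  No cited facts; the manuscripts under audit are not used for anything.

Version v2.1 (2026-08-19, b2b-balaban-beta-an2-g5; v2 = p184034; v2.1 is a DOCSTRING-ONLY wording fix — «minimiser» ↦
«solution operator of the typed KKT system» in prose + the READING paragraph; identifiers unchanged; v1 = p183458, same
statements over `Beta/KernelSpecIdentityForm`, bounced only because its imports were not yet in the tree).  value = kernel composition leaf (the `hid` binder's solution-operator-side
data discharged), NOT summit progress; NOT continuum, NOT Clay.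
-/

noncomputable section

namespace Literature.MathematicalPhysics.QuantumFieldTheory.Balaban1983to89.Beta.MinimiserIdentityForm

open AffineReproduction (InfiniteVolumeSpec)
open DecimatedMomentSummable (AbsMoment₂ ConstReproSum LinReproSum)
open DressedMomentNormalisation (EKer dressedEntry EntryHyps coarseTensor m2Tensor coarseTensor_eq_m2Tensor
  secondMoment_dressedEntry_hasSum_lattice bondSecondMoment_hasSum identityForm_of_kernelFamilies
  identityForm_of_kernelFamilies')
open KernelRepresentationSummable (kernelOpSum lowMomentsSum_of_symmetries)
open KernelSpecInstance (wH specK specK_H absMoment₂_wH lowMomentsSum_specK)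

variable {N : ℕ}

/-! ## §1 Fixed block size: the entry hypotheses of the normalisation last mile for the solution-operator kernel -/

/-- The four-dimensional RESPONSE KERNEL of the typed KKT solution operator at block size `N`: `wK N κ l z = Re (A-component κ at z of the
fundamental column with unit Q-row source in direction l)` = `KernelSpecInstance.wH` at `d + 1 = 4`. [folklore] -/
abbrev wK (N : ℕ) [NeZero N] : EKer 4 := wH (d := 3) (N := N)

/-- The four-dimensional solution-operator SPEC at block size `N` (= `KernelSpecInstance.specK` at `d + 1 = 4`). [folklore] -/
abbrev specK4 (N : ℕ) [NeZero N] : InfiniteVolumeSpec 4 N := specK (d := 3) (N := N)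

/-- The kernel representation of `specK4` holds by `rfl`. [folklore] -/
theorem specK4_H [NeZero N] : (specK4 N).H = kernelOpSum N (wK N) := specK_H (d := 3) (N := N)

/-- Every entry of the solution operator's response kernel has an absolute second moment. [folklore] -/
theorem absMoment₂_wK [NeZero N] : ∀ κ l : Fin 4, AbsMoment₂ (wK N κ l) := absMoment₂_wH (d := 3) (N := N)

/-- (L0∞)/(L1∞) FOR THE SOLUTION-OPERATOR KERNEL in four dimensions: the windowed coset moments of `wK N` — constants reproduced
with the diagonal value `N^{-5}`, linear functions reproduced up to a coset-independent constant. [folklore] -/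
theorem lowMoments_wK [NeZero N] :
    (∀ κ l : Fin 4, ConstReproSum N (wK N κ l) (if κ = l then (((N : ℝ) ^ (4 + 1))⁻¹) else 0))
      ∧ ∀ κ l : Fin 4, ∃ C : Fin 4 → ℝ, LinReproSum N (wK N κ l) C :=
  lowMomentsSum_specK (d := 3) (N := N)

/-- **THE ENTRY HYPOTHESES OF THE NORMALISATION LAST MILE HOLD FOR THE SOLUTION-OPERATOR KERNEL**: given only Hessian-kernel
data (`AbsMoment₂` entries, (T0), (T1)), `EntryHyps N (wK N) T`. [folklore] -/
theorem entryHyps_minimiser [NeZero N] (T : EKer 4) (hTA : ∀ c e, AbsMoment₂ (T c e))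
    (hT0 : ∀ c e, HasSum (T c e) 0) (hT1 : ∀ c e (μ : Fin 4), HasSum (fun t : Fin 4 → ℤ => t μ • T c e t) 0) :
    EntryHyps N (wK N) T where
  pos := Nat.pos_of_ne_zero (NeZero.ne N)
  const := lowMoments_wK.1
  lin := lowMoments_wK.2
  absW := absMoment₂_wK
  absT := hTA
  T0 := hT0
  T1 := hT1

/-- … with (T0)/(T1) discharged from the backward-difference DIVERGENCE-FREENESS of `T` in its first index and its
MIDPOINT-INVERSION symmetry (the raw binders of `KernelRepresentationSummable.lowMomentsSum_of_symmetries`). [folklore] -/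
theorem entryHyps_minimiser_of_symmetries [NeZero N] (T : EKer 4) (hTA : ∀ c e, AbsMoment₂ (T c e))
    (hdiv : ∀ (ν : Fin 4) (x : Fin 4 → ℤ), ∑ μ, (T μ ν x - T μ ν (x - Pi.single μ 1)) = 0)
    (hinv : ∀ (μ ν : Fin 4) (y : Fin 4 → ℤ), T μ ν ((Pi.single ν 1 - Pi.single μ 1) - y) = T μ ν y) :
    EntryHyps N (wK N) T := by
  obtain ⟨h0, h1⟩ := lowMomentsSum_of_symmetries T hTA hdiv hinv
  exact entryHyps_minimiser T hTA h0 fun c e μ => h1 μ c e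

/-- THE DECIMATED SECOND MOMENT OF THE DRESSED SOLUTION-OPERATOR KERNEL `Wᵀ T W` (four dimensions): weight `(N z)_κ (N z)_λ`,
sum `N^{-6} · Σ'_t t_κ t_λ T a b t`. [folklore] -/
theorem secondMoment_dressedEntry_minimiser [NeZero N] (T : EKer 4) (hTA : ∀ c e, AbsMoment₂ (T c e))
    (hT0 : ∀ c e, HasSum (T c e) 0) (hT1 : ∀ c e (μ : Fin 4), HasSum (fun t : Fin 4 → ℤ => t μ • T c e t) 0)
    (κ lam a b : Fin 4) :
    HasSum (fun z : Fin 4 → ℤ => ((N : ℤ) ^ 2 * (z κ * z lam)) • dressedEntry (wK N) T ((N : ℤ) • z) a b)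
      ((((N : ℝ) ^ (4 + 2))⁻¹) * ∑' t : Fin 4 → ℤ, (t κ * t lam) • T a b t) :=
  secondMoment_dressedEntry_hasSum_lattice (Nat.pos_of_ne_zero (NeZero.ne N)) (wK N) T lowMoments_wK.1
    lowMoments_wK.2 absMoment₂_wK hTA hT0 hT1 κ lam a b

/-- BOND NORMALISATION for the dressed solution-operator kernel (four dimensions): the coarse bond second moment in coarse
units has the sum `(N^4 / N^4) · Σ'_t t_κ t_λ T a b t`. [folklore] -/
theorem bondSecondMoment_minimiser [NeZero N] (T : EKer 4) (hTA : ∀ c e, AbsMoment₂ (T c e))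
    (hT0 : ∀ c e, HasSum (T c e) 0) (hT1 : ∀ c e (μ : Fin 4), HasSum (fun t : Fin 4 → ℤ => t μ • T c e t) 0)
    (κ lam a b : Fin 4) :
    HasSum (fun z : Fin 4 → ℤ =>
        ((z κ * z lam : ℤ) : ℝ) * ((N : ℝ) ^ (2 * 4) * dressedEntry (wK N) T ((N : ℤ) • z) a b))
      ((N : ℝ) ^ 4 / (N : ℝ) ^ 4 * ∑' t : Fin 4 → ℤ, (t κ * t lam) • T a b t) :=
  bondSecondMoment_hasSum (Nat.pos_of_ne_zero (NeZero.ne N)) (wK N) T lowMoments_wK.1 lowMoments_wK.2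
    absMoment₂_wK hTA hT0 hT1 κ lam a b

/-- **THE COARSE BOND TENSOR OF THE DRESSED SOLUTION-OPERATOR KERNEL IS `m2Tensor T`** at every fixed block size. [folklore] -/
theorem coarseTensor_minimiser [NeZero N] (T : EKer 4) (hTA : ∀ c e, AbsMoment₂ (T c e))
    (hT0 : ∀ c e, HasSum (T c e) 0) (hT1 : ∀ c e (μ : Fin 4), HasSum (fun t : Fin 4 → ℤ => t μ • T c e t) 0) :
    coarseTensor N (wK N) T = m2Tensor T :=
  coarseTensor_eq_m2Tensor (entryHyps_minimiser T hTA hT0 hT1)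

/-- … with (T0)/(T1) from the two symmetries. [folklore] -/
theorem coarseTensor_minimiser_of_symmetries [NeZero N] (T : EKer 4) (hTA : ∀ c e, AbsMoment₂ (T c e))
    (hdiv : ∀ (ν : Fin 4) (x : Fin 4 → ℤ), ∑ μ, (T μ ν x - T μ ν (x - Pi.single μ 1)) = 0)
    (hinv : ∀ (μ ν : Fin 4) (y : Fin 4 → ℤ), T μ ν ((Pi.single ν 1 - Pi.single μ 1) - y) = T μ ν y) :
    coarseTensor N (wK N) T = m2Tensor T :=
  coarseTensor_eq_m2Tensor (entryHyps_minimiser_of_symmetries T hTA hdiv hinv)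

/-! ## §2 Families of scales: `IdentityForm` for the solution-operator kernels -/

/-- **`IdentityForm` FOR THE SOLUTION-OPERATOR KERNELS.**  For ANY nonzero block sizes `Nf j k`, Hessian kernels `T j` with
`AbsMoment₂` entries and (T0)/(T1), and ANY read-out `F` of the second-moment tensor, the coefficients
`μ j k := F (coarseTensor (Nf j k) (wK (Nf j k)) (T j))` and `β0 j := F (m2Tensor (T j))` satisfy
`MarginalTelescoping.IdentityForm μ β0` — with NO hypothesis on the solution-operator side. [folklore] -/
theorem identityForm_of_minimiserFamilies (Nf : ℕ → ℕ → ℕ) [hN : ∀ j k, NeZero (Nf j k)] (T : ℕ → EKer 4)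
    (hTA : ∀ j c e, AbsMoment₂ (T j c e)) (hT0 : ∀ j c e, HasSum (T j c e) 0)
    (hT1 : ∀ j c e (μ : Fin 4), HasSum (fun t : Fin 4 → ℤ => t μ • T j c e t) 0)
    (F : (Fin 4 → Fin 4 → Fin 4 → Fin 4 → ℝ) → ℝ) :
    MarginalTelescoping.IdentityForm (fun j k => F (coarseTensor (Nf j k) (wK (Nf j k)) (T j)))
      (fun j => F (m2Tensor (T j))) :=
  identityForm_of_kernelFamilies Nf (fun j k => wK (Nf j k)) T
    (fun j k _ => entryHyps_minimiser (N := Nf j k) (T j) (hTA j) (hT0 j) (hT1 j)) F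

/-- … hence, for any target sequence `β0` IDENTIFIED with the read-out of the `M2` tensors (`hβ`, the `hident` side, a
hypothesis), `IdentityForm μ β0` for the solution-operator coefficients. [folklore] -/
theorem identityForm_of_minimiserFamilies' (Nf : ℕ → ℕ → ℕ) [hN : ∀ j k, NeZero (Nf j k)] (T : ℕ → EKer 4)
    (hTA : ∀ j c e, AbsMoment₂ (T j c e)) (hT0 : ∀ j c e, HasSum (T j c e) 0)
    (hT1 : ∀ j c e (μ : Fin 4), HasSum (fun t : Fin 4 → ℤ => t μ • T j c e t) 0)
    (F : (Fin 4 → Fin 4 → Fin 4 → Fin 4 → ℝ) → ℝ) {β0 : ℕ → ℝ} (hβ : ∀ j, β0 j = F (m2Tensor (T j))) :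
    MarginalTelescoping.IdentityForm (fun j k => F (coarseTensor (Nf j k) (wK (Nf j k)) (T j))) β0 :=
  identityForm_of_kernelFamilies' Nf (fun j k => wK (Nf j k)) T
    (fun j k _ => entryHyps_minimiser (N := Nf j k) (T j) (hTA j) (hT0 j) (hT1 j)) F hβ

/-- **`IdentityForm` FOR THE SOLUTION-OPERATOR KERNELS AND SYMMETRIC HESSIAN KERNELS**: (T0)/(T1) of every `T j` discharged
from divergence-freeness and midpoint inversion. [folklore] -/
theorem identityForm_of_minimiserFamilies_of_symmetries (Nf : ℕ → ℕ → ℕ) [hN : ∀ j k, NeZero (Nf j k)]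
    (T : ℕ → EKer 4) (hTA : ∀ j c e, AbsMoment₂ (T j c e))
    (hdiv : ∀ j (ν : Fin 4) (x : Fin 4 → ℤ), ∑ μ, (T j μ ν x - T j μ ν (x - Pi.single μ 1)) = 0)
    (hinv : ∀ j (μ ν : Fin 4) (y : Fin 4 → ℤ), T j μ ν ((Pi.single ν 1 - Pi.single μ 1) - y) = T j μ ν y)
    (F : (Fin 4 → Fin 4 → Fin 4 → Fin 4 → ℝ) → ℝ) :
    MarginalTelescoping.IdentityForm (fun j k => F (coarseTensor (Nf j k) (wK (Nf j k)) (T j)))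
      (fun j => F (m2Tensor (T j))) :=
  identityForm_of_kernelFamilies Nf (fun j k => wK (Nf j k)) T
    (fun j k _ => entryHyps_minimiser_of_symmetries (N := Nf j k) (T j) (hTA j) (hdiv j) (hinv j)) F

/-- The cell's GEOMETRIC block sizes `Nf j k = L ^ (k − j)` (`L ≠ 0`): `IdentityForm` for the solution-operator kernels.
[folklore] -/
theorem identityForm_of_minimiserFamilies_pow (L : ℕ) [NeZero L] (T : ℕ → EKer 4)
    (hTA : ∀ j c e, AbsMoment₂ (T j c e)) (hT0 : ∀ j c e, HasSum (T j c e) 0)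
    (hT1 : ∀ j c e (μ : Fin 4), HasSum (fun t : Fin 4 → ℤ => t μ • T j c e t) 0)
    (F : (Fin 4 → Fin 4 → Fin 4 → Fin 4 → ℝ) → ℝ) :
    MarginalTelescoping.IdentityForm (fun j k => F (coarseTensor (L ^ (k - j)) (wK (L ^ (k - j))) (T j)))
      (fun j => F (m2Tensor (T j))) :=
  identityForm_of_minimiserFamilies (fun j k => L ^ (k - j)) T hTA hT0 hT1 F

/-- … and with symmetric Hessian kernels. [folklore] -/
theorem identityForm_of_minimiserFamilies_pow_of_symmetries (L : ℕ) [NeZero L] (T : ℕ → EKer 4)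
    (hTA : ∀ j c e, AbsMoment₂ (T j c e))
    (hdiv : ∀ j (ν : Fin 4) (x : Fin 4 → ℤ), ∑ μ, (T j μ ν x - T j μ ν (x - Pi.single μ 1)) = 0)
    (hinv : ∀ j (μ ν : Fin 4) (y : Fin 4 → ℤ), T j μ ν ((Pi.single ν 1 - Pi.single μ 1) - y) = T j μ ν y)
    (F : (Fin 4 → Fin 4 → Fin 4 → Fin 4 → ℝ) → ℝ) :
    MarginalTelescoping.IdentityForm (fun j k => F (coarseTensor (L ^ (k - j)) (wK (L ^ (k - j))) (T j)))
      (fun j => F (m2Tensor (T j))) :=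
  identityForm_of_minimiserFamilies_of_symmetries (fun j k => L ^ (k - j)) T hTA hdiv hinv F

end Literature.MathematicalPhysics.QuantumFieldTheory.Balaban1983to89.Beta.MinimiserIdentityForm

end
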